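import Summits.HodgeConjecture.CorCM.HypLiu418.S2primeSockets
import Literature.NumberTheory.Automorphic.Liu2021.AppendixC.OmegaHomBlockMultOne
import HarnessLib

/-!
# [Liu 2021, App. D, proof of Thm. D.6 (1)] the S2′ step «`H¹_B(A_K, ℚ)[π^∞]` has a CM block» — ASSEMBLY

Summits-side placement (director s216/s216a: the socket predicates are instantiated and consumed here); namespace `Summit.HodgeConjecture.CorCM.HypLiu418.S2prime` over the `Literature…Liu2021.AppendixC` currency.
THEOREMS ONLY (no definition, no named fact, no instance, no `sorry`); sequel of `S2primeSockets`.

The base theorem `blockShape'_of_socketBlockFieldPos` builds the CM block of `BlockShape'` by the RANK-ONE road: the block `ε ∈ H_K` of a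
non-zero `f ∈ Hom_G(ι ∘ ω, ℚ̄_ℓ ⊗ H¹_ét)` at a level `K` fixing a witness vector (★ `exists_blockProjector'`); the block field
`φ : R₀ ≅ Z(H_K)·ε` with its trace-non-negative `ρ` (`SocketBlockFieldPos`); the Betti block module `V = range (ψ ε)` of a faithful rational
representation with the degree identity `[R₀:ℚ] · dim act(H_K) = (dim V)²` (`SocketBlockModule`, `SocketHdim`) — so `act(H_K) = End_{R₀}(V)`
contains a RANK-ONE `R₀`-linear idempotent `e` (★ `exists_mem_isIdempotentElem_finrank_range_eq`); its pull-back `h₀ = ε·h ∈ H_K`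
(`h₀² = h₀`, commuting with `φ(R₀)`) is realised by an honest `u₀ : A_K ⟶ A_K` with `1 ⊗ u₀ = N • h₀` (★ `endAlgebra.exists_eq_algebraMap_mul_of`);
then `2 dim (Im u₀) = dim range e = [R₀:ℚ]`, the transport `([·]_K ∘ ᵗV_ℓ(A_K ↠ Im u₀)) ⊗ 1` is injective (★ `toTower_injective`,
★ `dualMap_rationalTateModuleMap_toImage_injective`), `R₀` acts on `Im u₀` through the corner (★ `exists_ringHom_endAlgebra_image_of_corner`),
and the label character of `SocketIso` transports the eigenclasses into the span of the block values.

Heads (all σ-free, i.e. without any `G`-level semisimplicity hypothesis; «irreducible» in Liu's sense `IsIrreducibleOrZero`, the zero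
carrier being vacuous):
* `blockShape'_of_socketsHZ` — from `SocketKw`, levelwise semisimplicity of the `H_K`, `SocketRosZ`, `SocketMO`;
* `blockShape'_of_socketsPH` — from `SocketKw`, `SocketRosH`, `SocketMO`;
* `blockShape'_of_socketsPHM1` — from `SocketKw`, `SocketRosH`, the (MO) producer statement on the irreducible branch, `SocketM1`;
* `blockShape'_of_RosH_M1` — from `SocketKw`, `SocketRosH`, `SocketM1` ONLY, the (MO) producer being the theorem
  ★ `Sec42Data.HeckeTranslates.exists_block_multOne` (`socketMultOne_of_hss`).

## References
* [Liu2021] Y. Liu, *Fourier–Jacobi cycles and arithmetic relative trace formula*, Camb. J. Math. 9 (2021), App. D, (D.3) p. 133,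
  Prop. D.4 (1), proof of Thm. D.6 (1) p. 140.
* [MumfordAV1970] D. Mumford, *Abelian Varieties*, §21 Thm. 1 (positivity of the Rosati involution).
-/

set_option autoImplicit false

noncomputable section

open CategoryTheory NumberField Function MulAction
open scoped TensorProduct

namespace Summit.HodgeConjecture.CorCM.HypLiu418

open Literature.NumberTheory.Automorphic.Liu2021 Literature.NumberTheory.Automorphic.Liu2021.AppendixC

open Literature.AlgebraicGeometry.Motives (AbelianVariety)
open Literature.AlgebraicGeometry.Motives.AbelianVariety (rationalTateModuleMap endAlgebra rationalTateAction image toImage)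

variable {F E : Type} [Field F] [NumberField F] [IsTotallyReal F] [Field E] [NumberField E] [Algebra F E]
  [IsTotallyComplex E] [Algebra.IsQuadraticExtension F E]
variable {P5 : PropC5Data F E} {isotropicAt : ℕ → Prop}

namespace S2prime

open Literature.AlgebraicGeometry.Motives
open scoped Matrix

variable {C : Sec42Data P5 isotropicAt} (ℓ : ℕ) [Fact ℓ.Prime] (X : C.EtaleHeckeDatum ℓ)
  (ι : ℂ ≃+* AlgebraicClosure ℚ_[ℓ]) {W : Type} [AddCommGroup W] [Module ℂ W] (ρW : Representation ℂ C.G W)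
  (T : C.HeckeTranslates) (hD : T.IsogenyDescent)

/-! ## §1 The theorem-fed sockets -/

/-- `SocketHdim` from `SocketMO`: ★ `finrank_mul_finrank_range_eq_sq_of_exists_block` at the ambient `ℓ`, the comparison of ★ `exists_ratRep_tateComparison`, and the model `(range (ψ ε)).subtype`. [cite: Liu2021, App. D, proof of Thm. D.6 (1) (p. 140)] -/
theorem socketHdim_of_MO (hMO : SocketMO ℓ X ι ρW T hD) : SocketHdim ℓ X ι ρW T hD := by
  intro K f hf hf0 ε hεH hεcp hsel hεi _ hεc R₀ _ _ φ hφinj hφmul hφ1 hφH hφc hφsurj κ _ _ ψ _ hcmp act hact hker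
  obtain ⟨c, hc⟩ := hcmp ℓ
  exact Literature.AlgebraicGeometry.ComplexMultiplication.finrank_mul_finrank_range_eq_sq_of_exists_block (C.A K) ℓ ψ c hc
    (T.heckeImage hD K) hεi hεH hεc φ hφinj hφmul hφ1 hφH hφc hφsurj (Submodule.subtype _) Subtype.val_injective
    (Submodule.range_subtype _) act (fun h v => hact h v) hker (hMO K f hf hf0 ε hεH hεcp hsel)

variable {T hD} in
/-- `SocketM1` from the «pairwise proportional» phrasing of multiplicity one (`g = a • f ∨ f = a • g` for all `f, g` in the Hom-space): if `f = a • g` with `f w ≠ 0` then `a ≠ 0` and `g = a⁻¹ • f`. [cite: Liu2021, App. D, Prop. D.4 (1)] -/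
theorem socketM1_of_pairwise
    (hpp : ∀ f ∈ X.omegaHom ι ρW, ∀ g ∈ X.omegaHom ι ρW, ∃ a : AlgebraicClosure ℚ_[ℓ], g = a • f ∨ f = a • g) :
    SocketM1 ℓ X ι ρW := by
  intro f hf hf0 f₁ hf₁
  obtain ⟨w, hw⟩ := hf0
  obtain ⟨a, h | h⟩ := hpp f hf f₁ hf₁
  · exact ⟨a, h⟩
  · have ha : a ≠ 0 := by
      rintro rfl
      exact hw (by rw [h, zero_smul, LinearMap.zero_apply])
    exact ⟨a⁻¹, by rw [h, smul_smul, inv_mul_cancel₀ ha, one_smul]⟩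

/-- `SocketMO` from `SocketMultOne` and `SocketM1`: the faithful rational representation and its `ℓ`-adic comparison come from ★ `exists_ratRep_tateComparison (C.A K)`, and `ε` commutes with `H_K` by central primitivity. [cite: Liu2021, App. D, Prop. D.4 (1)] [cite: Liu2021, App. D, proof of Thm. D.6 (1) (p. 140)] -/
theorem socketMO_of_multOne (hM : SocketMultOne ℓ X ι ρW T hD) (hm1 : SocketM1 ℓ X ι ρW) : SocketMO ℓ X ι ρW T hD := by
  intro K f hf hf0 ε hεH hεcp hsel
  obtain ⟨κ, _, _, ψ, -, -, hcmp⟩ := Literature.AlgebraicGeometry.ComplexMultiplication.exists_ratRep_tateComparison (C.A K)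
  obtain ⟨c, hc⟩ := hcmp ℓ
  have hεc : ∀ h ∈ T.heckeImage hD K, ε * h = h * ε := fun h hh => congrArg Subtype.val (hεcp.comm ⟨h, hh⟩)
  exact hM K f hf hf0 ε hεH hεcp hεc hsel κ ψ c hc (hm1 f hf (hf0.imp fun w hw => hw.2))

/-- **`SocketMultOne` from levelwise semisimplicity of the Hecke images** — ★ `Sec42Data.HeckeTranslates.exists_block_multOne` with `hHK := hH K`, `hssM K′ :=` ★ `isSemisimpleModule_baseChange_etaleH1_of_isSemisimpleRing_heckeImage (hH K′)`, and the base-changed tower representation `σ = 1 ⊗ rhoEt` CONSTRUCTED (`Module.End.baseChangeHom ∘ rhoEt`). [cite: Liu2021, App. D, Prop. D.4 (1)] [cite: Liu2021, p. 133 (D.3)] -/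
theorem socketMultOne_of_hss [ρW.IsIrreducible]
    (hI : ∀ ⦃K K' : C5.SmallLevel C.S.K₀⦄ (g : K' ⟶ K), Function.Injective (rationalTateModuleMap ℓ (C.Atr g)).dualMap)
    (hX : X.rhoEt = T.etHeckeRep ℓ) (hH : ∀ K : C5.SmallLevel C.S.K₀, IsSemisimpleRing ↥(T.heckeImage hD K)) :
    SocketMultOne ℓ X ι ρW T hD := by
  obtain ⟨σ, hσ⟩ : ∃ σ : Representation (AlgebraicClosure ℚ_[ℓ]) C.G (AlgebraicClosure ℚ_[ℓ] ⊗[ℚ_[ℓ]] C.etaleH1Tower ℓ),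
      ∀ g : C.G, σ g = (X.rhoEt g).baseChange (AlgebraicClosure ℚ_[ℓ]) :=
    ⟨(Module.End.baseChangeHom ℚ_[ℓ] (AlgebraicClosure ℚ_[ℓ]) (C.etaleH1Tower ℓ)).toMonoidHom.comp X.rhoEt, fun _ => rfl⟩
  intro K f hf hf0 ε hεH hεcp hεc hsel κ _ _ ψ c hc hm1
  exact T.exists_block_multOne K hI X hX ι ρW hf hf0 σ hσ hD (hH K)
    (fun K' => T.isSemisimpleModule_baseChange_etaleH1_of_isSemisimpleRing_heckeImage ℓ K' hD (hH K') _ rfl)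
    hεH hεcp hεc hsel ψ c hc hm1

/-- `SocketMultOne` from `SocketRosH` (the involution on `H_K` gives the levelwise semisimplicity, Mumford §21 Thm. 1). [cite: Liu2021, App. D, Prop. D.4 (1)] [cite: MumfordAV1970, §21 Thm. 1] -/
theorem socketMultOne_of_socketRosH [ρW.IsIrreducible]
    (hI : ∀ ⦃K K' : C5.SmallLevel C.S.K₀⦄ (g : K' ⟶ K), Function.Injective (rationalTateModuleMap ℓ (C.Atr g)).dualMap)
    (hX : X.rhoEt = T.etHeckeRep ℓ) (hRosH : SocketRosH T hD) : SocketMultOne ℓ X ι ρW T hD :=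
  socketMultOne_of_hss ℓ X ι ρW T hD hI hX (isSemisimpleRing_heckeImage_of_socketRosH T hD hRosH)

/-! ## §2 The base assembly -/

/-- **The S2′ assembly (base form): `BlockShape'` from `SocketKw`, the block-field datum `SocketBlockFieldPos`, the Betti block module `SocketBlockModule` with its degree identity `SocketHdim`, and the label character `SocketIso`**, for a Mathlib-irreducible carrier.  Rank-one road as described in the module docstring; `hI` = injectivity of the pull-backs `ᵗV_ℓ(A_K ← A_{K'})` along the tower, `hX` = the étale Hecke datum is the one induced by the translates. [cite: Liu2021, App. D, proof of Thm. D.6 (1) (p. 140)] -/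
theorem blockShape'_of_socketBlockFieldPos [ρW.IsIrreducible]
    (hI : ∀ ⦃K K' : C5.SmallLevel C.S.K₀⦄ (g : K' ⟶ K), Function.Injective (rationalTateModuleMap ℓ (C.Atr g)).dualMap)
    (hX : X.rhoEt = T.etHeckeRep ℓ)
    (hKw : SocketKw C ρW) (hBF : SocketBlockFieldPos T hD) (hBM : SocketBlockModule T hD) (hHdim : SocketHdim ℓ X ι ρW T hD)
    (hIso : SocketIso ℓ X ι ρW T hD) :
    BlockShape' C ℓ X ι ρW := by
  classical
  intro hne
  refine hne.elim fun f hf' => hf'.2.elim fun w hw0 => ?_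
  have hf := hf'.1
  refine (hKw w).elim fun K hwK => ?_
  -- §a the block `ε` of `f` at level `K` (★ p752558 ed.2, by paste)
  obtain ⟨ε, uε, a₀, hεH, hεcp, hεi, hεc, ha₀, huε, huεq, hsel, -, -⟩ :=
    Sec42Data.HeckeTranslates.exists_blockProjector' T K hI X hX ι ρW hf hD ⟨w, hwK, hw0⟩
  have hε0 : ε ≠ 0 := fun h => hεcp.ne_zero (Subtype.ext h)
  have hεc' : ∀ h ∈ T.heckeImage hD K, ε * h = h * ε := fun h hh => (hεc h hh).symm
  -- §b the block field `φ : R₀ ≅ Z(heckeImage K)·ε` and the trace-non-negative `ρ` (socket `SocketBlockFieldPos`)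
  obtain ⟨R₀, hF, hNF, φ, hφinj, hφmul, hφ1, hφH, hφc, hφε, hφsurj, ρ, hρnn⟩ := hBF K ε hεH hεcp
  -- §c the Betti block module ((D2) ★ p754367 + (D2c) ★ p755062 + (D4), A-p04՚s composed head) and `hdim` ((D3-inst) ∘ (MO))
  obtain ⟨κ, _, _, ψ, hψ, -, hcmp, instM, instT, instF, instN, act, hact, -, hactZ, hactφ, hker, hdeg⟩ :=
    hBM K ε hεH hεi hε0 hεc' R₀ φ hφmul hφ1 hφH hφc
  have hdim := hHdim K f hf ⟨w, hwK, hw0⟩ ε hεH hεcp hsel hεi hε0 hεc' R₀ φ hφinj hφmul hφ1 hφH hφc hφsurj κ ψ hψ hcmp act hact hker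
  haveI : FiniteDimensional R₀ ↥(LinearMap.range (Matrix.mulVecLin (ψ ε))) := instF
  -- §d a rank-one `R₀`-linear idempotent `e ∈ HV := act.range` (★ p753523 (D1))
  have hHZ : ∀ g ∈ act.range, ∀ (z : R₀) (x : ↥(LinearMap.range (Matrix.mulVecLin (ψ ε)))), g (z • x) = z • g x := by
    intro g hg z x
    obtain ⟨h, rfl⟩ := act.mem_range.1 hg
    exact hactZ h z x
  refine (Literature.RingTheory.SimpleModule.exists_mem_isIdempotentElem_finrank_range_eq (k := ℚ) (Z := R₀)
      (V := ↥(LinearMap.range (Matrix.mulVecLin (ψ ε)))) act.range hHZ hdim).elim fun e he => ?_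
  have heHV := he.1
  have hei := he.2.1
  have heZ := he.2.2.1
  have hrank := he.2.2.2
  -- §e pull `e` back to an idempotent `h₀ ∈ ε · heckeImage K` commuting with `φ(R₀)`
  refine (act.mem_range.1 heHV).elim fun h hh => ?_
  refine (⟨_, rfl⟩ : ∃ h₀ : ↥(T.heckeImage hD K), h₀ = ⟨ε, hεH⟩ * h).elim fun h₀ hh₀def => ?_
  have hεh₀ : ε * (h₀ : (C.A K).endAlgebra) = h₀ := by
    rw [hh₀def]
    change ε * (ε * (h : (C.A K).endAlgebra)) = ε * (h : (C.A K).endAlgebra)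
    rw [← mul_assoc, hεi.eq]
  have hactε : act ⟨ε, hεH⟩ = 1 := by
    have h0 : act (1 - ⟨ε, hεH⟩) = 0 := (hker _).2 (by
      change ε * (1 - ε) = 0
      rw [mul_sub, mul_one, hεi.eq, sub_self])
    rw [map_sub, map_one, sub_eq_zero] at h0
    exact h0.symm
  have hacth₀ : act h₀ = e := by
    rw [hh₀def, map_mul, hactε, one_mul, hh]
  have hh₀i : (h₀ : (C.A K).endAlgebra) * h₀ = h₀ := by
    have h1 : act (h₀ * h₀ - h₀) = 0 := by rw [map_sub, map_mul, hacth₀, hei.eq, sub_self]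
    have h2 : ε * ((h₀ : (C.A K).endAlgebra) * h₀ - h₀) = 0 := (hker _).1 h1
    rwa [mul_sub, ← mul_assoc, hεh₀, sub_eq_zero] at h2
  have hh₀φ : ∀ r : R₀, φ r * (h₀ : (C.A K).endAlgebra) = h₀ * φ r := by
    intro r
    have h1 : act (⟨φ r, hφH r⟩ * h₀ - h₀ * ⟨φ r, hφH r⟩) = 0 := by
      rw [map_sub, map_mul, map_mul, hacth₀, sub_eq_zero]
      apply LinearMap.ext
      intro x
      change act ⟨φ r, hφH r⟩ (e x) = e (act ⟨φ r, hφH r⟩ x)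
      rw [hactφ, hactφ, heZ]
    have h2 : ε * (φ r * (h₀ : (C.A K).endAlgebra) - h₀ * φ r) = 0 := (hker _).1 h1
    rw [mul_sub, ← mul_assoc, ← mul_assoc, hεc' (φ r) (hφH r), mul_assoc (φ r) ε (h₀ : (C.A K).endAlgebra), hεh₀,
      sub_eq_zero] at h2
    exact h2
  -- §f an honest multiple `u₀` of `h₀`: `1 ⊗ u₀ = N • h₀`, `u₀ ≫ u₀ = N • u₀`
  refine (AbelianVariety.endAlgebra.exists_eq_algebraMap_mul_of (h₀ : (C.A K).endAlgebra)).elim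
    fun N hN' => hN'.elim fun u₀ hNu => ?_
  have hN := hNu.1
  have hu₀ := hNu.2
  have hNq : (N : ℚ) ≠ 0 := Nat.cast_ne_zero.2 hN
  have hofu₀ : endAlgebra.of (C.A K) u₀ = (N : ℚ) • (h₀ : (C.A K).endAlgebra) := by
    rw [hu₀, Algebra.smul_def, ← mul_assoc, ← map_mul, mul_inv_cancel₀ hNq, map_one, one_mul]
  have hinj_of : Function.Injective (endAlgebra.of (C.A K)) :=
    AbelianVariety.endAlgebra.of_injective_of_isIsogeny_zsmul_id (AbelianVariety.isIsogeny_zsmul_id_holds (C.A K))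
  have hu₀q : u₀ ≫ u₀ = N • u₀ := by
    have h1 : endAlgebra.of (C.A K) (u₀ ≫ u₀) = endAlgebra.of (C.A K) (N • u₀) := by
      change endAlgebra.of (C.A K) (u₀ * u₀) = _
      rw [map_mul, map_nsmul, hofu₀, smul_mul_assoc, mul_smul_comm, hh₀i, ← Nat.cast_smul_eq_nsmul ℚ N]
    exact hinj_of h1
  -- §g the DEGREE: `2·dim(Im u₀) = dim_ℚ(range e) = [R₀:ℚ]`
  have hdeg₀ : 2 * (image u₀).dim = Module.finrank ℚ R₀ := by
    rw [hdeg h₀ u₀ N hu₀q hN hεh₀ hofu₀, hacth₀, hrank]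
  have hpos : 0 < (image u₀).dim := by
    have hR : 0 < Module.finrank ℚ R₀ := Module.finrank_pos
    omega
  -- §h injectivity of the transport (★ (J1a) + `[·]_K` injective below the threshold)
  have hinjT : Function.Injective
      ((C.toTower ℓ K ∘ₗ (rationalTateModuleMap ℓ (toImage u₀)).dualMap).baseChange (AlgebraicClosure ℚ_[ℓ])) := by
    rw [LinearMap.baseChange_comp]
    exact (toTower_baseChange_injective C ℓ (C.toTower_injective ℓ hI K)).comp
      (Module.Flat.lTensor_preserves_injective_linearMap (M := AlgebraicClosure ℚ_[ℓ]) _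
        (AbelianVariety.dualMap_rationalTateModuleMap_toImage_injective ℓ hu₀q hN))
  -- §i the corner action `j : R₀ →+* End⁰(Im u₀)` (★ p752842 (α″-3))
  let φₙ : R₀ →ₙ+* (C.A K).endAlgebra :=
    { toFun := φ, map_mul' := hφmul, map_zero' := map_zero φ, map_add' := map_add φ }
  have hφₙ : ∀ r, φₙ r = φ r := fun r => rfl
  have hcomm : ∀ r : R₀, φₙ r * endAlgebra.of (C.A K) u₀ = endAlgebra.of (C.A K) u₀ * φₙ r := fun r => by
    rw [hφₙ, hofu₀, mul_smul_comm, smul_mul_assoc, hh₀φ]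
  have hunit : φₙ 1 * endAlgebra.of (C.A K) u₀ = endAlgebra.of (C.A K) u₀ := by
    rw [hφₙ, hφ1, hofu₀, mul_smul_comm, hεh₀]
  refine (AbelianVariety.exists_ringHom_endAlgebra_image_of_corner φₙ hN hu₀q hcomm hunit).elim fun j hj => ?_
  have hjT := hj.2
  -- §j the label character and (4′) (socket hIso) through the eigen-transport of ★ p752842
  refine (hIso K f hf ⟨w, hwK, hw0⟩ ε hεH hsel R₀ φ hφinj hφmul hφ1 hφH hφc hφsurj).elim fun τ₀ hτ₀ => ?_
  -- (4′) for the classes on `Im u₀`: eigen-transport along `ū₀` (★ p752842) then the socket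
  have h4 : ∀ f₀ : AlgebraicClosure ℚ_[ℓ] ⊗[ℚ_[ℓ]] Module.Dual ℚ_[ℓ] ((image u₀).rationalTateModule ℓ),
      (∀ r : R₀, ((rationalTateAction (image u₀) ℓ (j r)).dualMap).baseChange (AlgebraicClosure ℚ_[ℓ]) f₀ = ι (τ₀ r) • f₀) →
        ((C.toTower ℓ K ∘ₗ (rationalTateModuleMap ℓ (toImage u₀)).dualMap).baseChange (AlgebraicClosure ℚ_[ℓ])) f₀ ∈
          Submodule.span (AlgebraicClosure ℚ_[ℓ]) {y | ∃ f ∈ X.omegaHom ι ρW, ∃ w : W, f w = y} := by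
    intro f₀ hf₀
    have hm : ∀ r : R₀, ((rationalTateAction (C.A K) ℓ (φ r)).dualMap).baseChange (AlgebraicClosure ℚ_[ℓ])
        ((((rationalTateModuleMap ℓ (toImage u₀)).dualMap).baseChange (AlgebraicClosure ℚ_[ℓ])) f₀) =
        ι (τ₀ r) • (((rationalTateModuleMap ℓ (toImage u₀)).dualMap).baseChange (AlgebraicClosure ℚ_[ℓ])) f₀ := by
      intro r
      have h := AbelianVariety.baseChange_dualMap_toImage_eq_smul_of_corner φₙ ℓ (hjT ℓ r) (AlgebraicClosure ℚ_[ℓ])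
        (ι (τ₀ r)) f₀ (hf₀ r)
      rw [hφₙ] at h
      exact h
    have h := hτ₀ _ hm
    have key : ((C.toTower ℓ K ∘ₗ (rationalTateModuleMap ℓ (toImage u₀)).dualMap).baseChange (AlgebraicClosure ℚ_[ℓ])) f₀ =
        (C.toTower ℓ K).baseChange (AlgebraicClosure ℚ_[ℓ])
          ((((rationalTateModuleMap ℓ (toImage u₀)).dualMap).baseChange (AlgebraicClosure ℚ_[ℓ])) f₀) := by
      rw [LinearMap.baseChange_comp]
      rfl
    rw [key]
    exact h
  exact ⟨K, u₀, N, hN, hu₀q, hpos, hinjT, R₀, hF, hNF, j, hdeg₀.symm, ⟨ρ, hρnn⟩, τ₀, h4⟩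

/-! ## §3 Heads -/

variable {X ι ρW T hD} in
/-- **Zero branch**: on a zero carrier `W` the guard of `BlockShape'` (a non-zero value of the Hom-space) is false. [cite: Liu2021, App. D, proof of Thm. D.6 (1) (p. 140)] -/
theorem blockShape'_of_subsingleton [Subsingleton W] : BlockShape' C ℓ X ι ρW := by
  rintro ⟨f, -, w, hw⟩
  exact absurd (by rw [Subsingleton.elim w 0, map_zero]) hw

/-- **`BlockShape'` from `SocketKw`, LEVELWISE SEMISIMPLICITY of the Hecke images, `SocketRosZ` and `SocketMO`** (Liu-irreducible carrier: zero branch vacuous, non-zero branch Mathlib-irreducible by ★ `isIrreducible_of_nontrivial`). [cite: Liu2021, App. D, proof of Thm. D.6 (1) (p. 140)] [cite: Liu2021, p. 133 (D.3)] -/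
theorem blockShape'_of_socketsHZ (hirr : Literature.NumberTheory.Automorphic.Liu2021.IsIrreducibleOrZero ρW)
    (hI : ∀ ⦃K K' : C5.SmallLevel C.S.K₀⦄ (g : K' ⟶ K), Function.Injective (rationalTateModuleMap ℓ (C.Atr g)).dualMap)
    (hX : X.rhoEt = T.etHeckeRep ℓ) (hKw : SocketKw C ρW)
    (hH : ∀ K : C5.SmallLevel C.S.K₀, IsSemisimpleRing ↥(T.heckeImage hD K)) (hRosZ : SocketRosZ T hD)
    (hMO : SocketMO ℓ X ι ρW T hD) : BlockShape' C ℓ X ι ρW := by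
  rcases subsingleton_or_nontrivial W with hW | hW
  · exact blockShape'_of_subsingleton ℓ
  · haveI := Literature.NumberTheory.Automorphic.Liu2021.isIrreducible_of_nontrivial hirr
    exact blockShape'_of_socketBlockFieldPos ℓ X ι ρW T hD hI hX hKw (socketBlockFieldPos_of_hss_of_socketRosZ T hD hH hRosZ)
      (socketBlockModule_holds T hD) (socketHdim_of_MO ℓ X ι ρW T hD hMO) (socketIso_of_hss ℓ X ι ρW T hD hI hX hH)

/-- **`BlockShape'` from `SocketKw`, `SocketRosH` and `SocketMO`** — the positive anti-involution of `H_K` supplies both the semisimplicity and the trace-positivity. [cite: Liu2021, App. D, proof of Thm. D.6 (1) (p. 140)] [cite: MumfordAV1970, §21 Thm. 1] -/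
theorem blockShape'_of_socketsPH (hirr : Literature.NumberTheory.Automorphic.Liu2021.IsIrreducibleOrZero ρW)
    (hI : ∀ ⦃K K' : C5.SmallLevel C.S.K₀⦄ (g : K' ⟶ K), Function.Injective (rationalTateModuleMap ℓ (C.Atr g)).dualMap)
    (hX : X.rhoEt = T.etHeckeRep ℓ) (hKw : SocketKw C ρW) (hRosH : SocketRosH T hD) (hMO : SocketMO ℓ X ι ρW T hD) :
    BlockShape' C ℓ X ι ρW :=
  blockShape'_of_socketsHZ ℓ X ι ρW T hD hirr hI hX hKw (isSemisimpleRing_heckeImage_of_socketRosH T hD hRosH)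
    (socketRosZ_of_socketRosH T hD hRosH) hMO

/-- **`BlockShape'` from `SocketKw`, `SocketRosH`, the (MO) producer statement on the irreducible branch, and multiplicity one `SocketM1`.** [cite: Liu2021, App. D, proof of Thm. D.6 (1) (p. 140)] [cite: Liu2021, App. D, Prop. D.4 (1)] -/
theorem blockShape'_of_socketsPHM1 (hirr : Literature.NumberTheory.Automorphic.Liu2021.IsIrreducibleOrZero ρW)
    (hI : ∀ ⦃K K' : C5.SmallLevel C.S.K₀⦄ (g : K' ⟶ K), Function.Injective (rationalTateModuleMap ℓ (C.Atr g)).dualMap)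
    (hX : X.rhoEt = T.etHeckeRep ℓ) (hKw : SocketKw C ρW) (hRosH : SocketRosH T hD)
    (hM : ρW.IsIrreducible → SocketMultOne ℓ X ι ρW T hD) (hm1 : SocketM1 ℓ X ι ρW) : BlockShape' C ℓ X ι ρW := by
  rcases subsingleton_or_nontrivial W with hW | hW
  · exact blockShape'_of_subsingleton ℓ
  · haveI := Literature.NumberTheory.Automorphic.Liu2021.isIrreducible_of_nontrivial hirr
    exact blockShape'_of_socketsPH ℓ X ι ρW T hD hirr hI hX hKw hRosH (socketMO_of_multOne ℓ X ι ρW T hD (hM ‹_›) hm1)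

/-- **THE TWO-SOCKET HEAD: `BlockShape'` from `SocketKw`, `SocketRosH` and multiplicity one `SocketM1`** (Liu-irreducible carrier), the (MO) producer being the theorem ★ `exists_block_multOne`.  With ★ `isSmoothRep`/`isIrreducibleOrZero` of the Weil carrier this leaves the Rosati positivity on `H_K` and [Liu2021] Prop. D.4 (1) as the inputs of the printed step. [cite: Liu2021, App. D, proof of Thm. D.6 (1) (p. 140)] [cite: Liu2021, App. D, Prop. D.4 (1)] [cite: MumfordAV1970, §21 Thm. 1] -/
theorem blockShape'_of_RosH_M1 (hirr : Literature.NumberTheory.Automorphic.Liu2021.IsIrreducibleOrZero ρW)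
    (hI : ∀ ⦃K K' : C5.SmallLevel C.S.K₀⦄ (g : K' ⟶ K), Function.Injective (rationalTateModuleMap ℓ (C.Atr g)).dualMap)
    (hX : X.rhoEt = T.etHeckeRep ℓ) (hKw : SocketKw C ρW) (hRosH : SocketRosH T hD) (hm1 : SocketM1 ℓ X ι ρW) :
    BlockShape' C ℓ X ι ρW :=
  blockShape'_of_socketsPHM1 ℓ X ι ρW T hD hirr hI hX hKw hRosH
    (fun _ => socketMultOne_of_socketRosH ℓ X ι ρW T hD hI hX hRosH) hm1

/-- The same with levelwise semisimplicity of the Hecke images and `SocketRosZ` in place of `SocketRosH` (the most primitive two-input form). [cite: Liu2021, App. D, proof of Thm. D.6 (1) (p. 140)] [cite: Liu2021, p. 133 (D.3)] -/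
theorem blockShape'_of_hss_RosZ_M1 (hirr : Literature.NumberTheory.Automorphic.Liu2021.IsIrreducibleOrZero ρW)
    (hI : ∀ ⦃K K' : C5.SmallLevel C.S.K₀⦄ (g : K' ⟶ K), Function.Injective (rationalTateModuleMap ℓ (C.Atr g)).dualMap)
    (hX : X.rhoEt = T.etHeckeRep ℓ) (hKw : SocketKw C ρW)
    (hH : ∀ K : C5.SmallLevel C.S.K₀, IsSemisimpleRing ↥(T.heckeImage hD K)) (hRosZ : SocketRosZ T hD) (hm1 : SocketM1 ℓ X ι ρW) :
    BlockShape' C ℓ X ι ρW := by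
  rcases subsingleton_or_nontrivial W with hW | hW
  · exact blockShape'_of_subsingleton ℓ
  · haveI := Literature.NumberTheory.Automorphic.Liu2021.isIrreducible_of_nontrivial hirr
    exact blockShape'_of_socketsHZ ℓ X ι ρW T hD hirr hI hX hKw hH hRosZ
      (socketMO_of_multOne ℓ X ι ρW T hD (socketMultOne_of_hss ℓ X ι ρW T hD hI hX hH) hm1)

end S2prime

end Summit.HodgeConjecture.CorCM.HypLiu418

end
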